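import Summits.BirchSwinnertonDyer.Rank1Residual.AdditivePotMult.QuadraticBaseChangeOddTamagawaUnits
import Summits.BirchSwinnertonDyer.Rank1Residual.AdditivePotMult.QuadraticTwistTamagawaAdditive
import Literature.NumberTheory.EllipticCurves.SzpiroMinimalityProofs
import Literature.NumberTheory.EllipticCurves.SzpiroLocalDataProofs
import Literature.NumberTheory.DiophantineGeometry.LocalReductionHasMultiplicativeReductionAtProofs
import HarnessLib

/-!
# Minimality and additive reduction persist above an unramified place of residue characteristic
# `≥ 5` (row T-MIL-ODD, FILE A-5K = the A-tail item "additive places unramified in `K`", fact-free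
# at `ℓ ≥ 5`; seat n1011-p01 GEN 6)

HONEST FRAMING (cell `b2b-bsdres`, run/shared/lean/b2b/bsd-rank1-residual/, verbatim in every
file): the goal of the cell is to DELETE the COMBINATION-SHAPED residual classes of the
Birch–Swinnerton-Dyer formula for ALL analytic-rank `≤ 1` elliptic curves over `ℚ` — "full BSD
formula for every rank `≤ 1` curve in class `C`" assembled STRICTLY from published theorems — so
that the rank-`≤ 1` remainder becomes exactly the CONSTRUCTION-SHAPED classes, which are TYPED
(missing-input `Prop`s), NOT attempted. This is not "finishing BSD". Sub-classes X3♯(M) / X4(M)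
(additive, potentially multiplicative prime; base-change-and-descend): a RESEARCH ROUTE; they stay
CONSTRUCTION-SHAPED; nothing is booked by this file; no mark / label moved. THEOREMS ONLY: no
definition, no named fact, no `sorry`.

## What and why (row T-MIL-ODD, `cells/n1011/skel/T-MIL-ODD.md` §1 (A≥5), A-tail)

At an ADDITIVE place `ℓ` of `W/ℚ` which is UNRAMIFIED in `K`, the `K`-side of the local identity
(L_ℓ)@p needs "`W_K` is additive at `w ∣ ℓ`" (then `c_w ≤ 4`, a `p`-unit for `p ≥ 5`). The skeleton
offered two routes: the named fact `kodairaSymbolAt_baseChange_of_ramificationIdx_eq_one` (A233,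
Silverman VII.5.4(a) — UNPROVED in the tree), or a FACT-FREE argument at `ℓ ≥ 5` through the
minimality criterion. This file does the latter:

* §1 `not_valuation_c₄_le_and_c₆_le_of_five_le`, `lt_valuation_c₄_or_lt_valuation_Δ_of_five_le` —
  for `V/ℚ` globally minimal and a place `v` over `ℓ ≥ 5`: NOT both `ord_v c₄ ≥ 4` and
  `ord_v c₆ ≥ 6`; hence `ord_v c₄ < 4` or `ord_v Δ < 12` (Silverman *AEC* VII.1 Remark 1.1 /
  Exercise 8.21: the rescaling `y² = x³ − 27c₄/ℓ⁴ x − 54c₆/ℓ⁶` would be an integral equation with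
  `ord Δ` smaller by `12`; the tree's `smul_eq_of_c₄_c₆` and `valuation_Δ_smul_le_of_isMinimalAt`
  (file `SzpiroMinimalityProofs`, there over `HeightOneSpectrum ℤ`) redone over the places of `𝓞 ℚ`,
  `valuation_six_pow_le_of_isMinimalAt`);
* §2 for `K` any number field and `w ∣ v` with `e(w|v) = 1`: the `ℤ`-minimal equation STAYS MINIMAL
  at `w` (`isMinimalAt_baseChange_of_five_le_of_ramificationIdx_eq_one`: `|x|_w = |x|_v` on `ℚ`, and
  the tree's criteria `isMinimalAt_of_lt_valuation_c₄` / `isMinimalAt_of_lt_valuation_Δ_holds`), so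
  `ord_w Δ_min(V_K) = ord_v Δ_min(V)`
  (`ordMinimalDiscriminant_baseChange_eq_of_five_le_of_ramificationIdx_eq_one`), ADDITIVE reduction
  persists (`hasAdditiveReductionAt_baseChange_of_five_le_of_ramificationIdx_eq_one`, Silverman
  VII.5.1(c) on minimal equations: tree `hasAdditiveReductionAt_iff_of_isMinimalAt`), and
  `v_p(c_w(V_K)) = 0` for `p ≥ 5` (`padicValNat_localTamagawaNumber_baseChange_eq_zero_of_addv_of_five_le`,
  Kodaira–Néron `c ≤ 4`, x11b `kodairaNeron_localTamagawaNumber`).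

In print: Silverman *AEC* VII.1 Remark 1.1, VII.5 Prop. 5.1 and 5.4(a), Ex. 7.1 and 8.21; Kramer 1981
Prop. 3. HONEST LIMITS: `ℓ ≥ 5` only (at `ℓ ∈ {2, 3}` minimality can fail the `(c₄, Δ)` test and
Tate's algorithm is needed — fact A233); TOOL theorems; closes no class; discharges no fact by
itself; the END on the enlarged population S₂ (additive places `ℓ ≥ 5` prime to `d_K`, `p ≥ 5`) is
the next file of the row.
-/

noncomputable section

open scoped Classical NumberField

open WeierstrassCurve NumberField IsDedekindDomain Rat.HeightOneSpectrum WithZero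
  Literature.NumberTheory.EllipticCurves
  Summit.BirchSwinnertonDyer.Rank1Residual.Additive

namespace Summit.BirchSwinnertonDyer.Rank1Residual.AdditivePotMult

/-! ## §1 The minimality constraint at `ℓ ≥ 5` in valuations (Silverman VII.1 Remark 1.1 / Ex. 8.21) -/

section Kraus

variable (v : HeightOneSpectrum (𝓞 ℚ))

/-- `|n|_v ≤ exp(−k) ⟺ ℓ^k ∣ n` for a non-zero integer `n` (`v ↔ ℓ`; FILE C-1
`valuation_rat_eq_exp_neg_padicValRat` and Mathlib `padicValInt_dvd_iff`). [folklore] -/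
theorem valuation_intCast_le_exp_neg_iff {n : ℤ} (hn : n ≠ 0) (k : ℕ) :
    v.valuation ℚ (n : ℚ) ≤ exp (-(k : ℤ)) ↔ ((primesEquiv v : ℕ) : ℤ) ^ k ∣ n := by
  haveI : Fact (Nat.Prime (primesEquiv v : ℕ)) := ⟨(primesEquiv v).2⟩
  have hnq : (n : ℚ) ≠ 0 := by exact_mod_cast hn
  rw [valuation_rat_eq_exp_neg_padicValRat v hnq, exp_le_exp, neg_le_neg_iff, padicValRat.of_int,
    padicValInt_dvd_iff]
  constructor
  · intro h; right; exact_mod_cast h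
  · rintro (h | h)
    · exact absurd h hn
    · exact_mod_cast h

/-- `ℓ^k ∣ n` from `|n|_v ≤ exp(−k)` (any integer `n`). [folklore] -/
theorem pow_dvd_of_valuation_intCast_le {n : ℤ} {k : ℕ}
    (h : v.valuation ℚ (n : ℚ) ≤ exp (-(k : ℤ))) : ((primesEquiv v : ℕ) : ℤ) ^ k ∣ n := by
  by_cases hn : n = 0
  · rw [hn]; exact dvd_zero _
  · exact (valuation_intCast_le_exp_neg_iff v hn k).mp h

/-- **Minimality bounds the rescaling** (Silverman *AEC* Ex. 8.21 with VII.1), over the places of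
`𝓞 ℚ`: if `M/ℤ` with `Δ ≠ 0` is minimal at `v` and `e⁴ a₄' = −27 c₄`, `e⁶ a₆' = −54 c₆` (`e ≠ 0`),
then the integral equation `y² = x³ + a₄' x + a₆'` (tree `smul_eq_of_c₄_c₆`; `e¹² Δ' = 6¹² Δ`) has
`ord_v Δ' ≥ ord_v Δ` (tree `valuation_Δ_smul_le_of_isMinimalAt`), i.e. `|6|_v¹² ≤ |e|_v¹²`. The
tree's `intValuation_pow_le_of_isMinimalAt` is the same over `HeightOneSpectrum ℤ`.
[cite: SilvermanAEC2009, Ex. 8.21 and VII.1 Remark 1.1] -/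
theorem valuation_six_pow_le_of_isMinimalAt (M : WeierstrassCurve ℤ) (hΔ : M.Δ ≠ 0)
    (hmin : (M.baseChange ℚ).IsMinimalAt v) {e a4 a6 : ℤ} (he : e ≠ 0)
    (h4 : e ^ 4 * a4 = -27 * M.c₄) (h6 : e ^ 6 * a6 = -54 * M.c₆) :
    v.valuation ℚ (6 : ℚ) ^ 12 ≤ v.valuation ℚ (e : ℚ) ^ 12 := by
  set M₁ : WeierstrassCurve ℤ := ⟨0, 0, 0, a4, a6⟩ with hM₁
  have hCW := smul_eq_of_c₄_c₆ M he h4 h6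
  have hint : (M₁.baseChange ℚ).IsIntegralAt v := by
    rw [baseChange, algebraMap_int_eq]
    have h := isIntegralAt_baseChange_intModel M₁ v
    rwa [baseChange, algebraMap_int_eq] at h
  have hle := valuation_Δ_smul_le_of_isMinimalAt v hmin _ (hCW ▸ hint)
  rw [hCW] at hle
  simp only [baseChange, map_Δ, algebraMap_int_eq, eq_intCast] at hle
  -- `e¹² Δ' = 6¹² Δ`
  have hΔ₁ : e ^ 12 * M₁.Δ = 6 ^ 12 * M.Δ := by
    have h1 : e ^ 12 * M₁.Δ = -64 * (e ^ 4 * a4) ^ 3 - 432 * (e ^ 6 * a6) ^ 2 := by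
      simp only [hM₁, WeierstrassCurve.Δ, WeierstrassCurve.b₂, WeierstrassCurve.b₄,
        WeierstrassCurve.b₆, WeierstrassCurve.b₈]
      ring
    rw [h4, h6] at h1
    linear_combination h1 - 1259712 * M.c_relation
  have hval := congrArg (fun z : ℤ => v.valuation ℚ (z : ℚ)) hΔ₁
  simp only [Int.cast_mul, Int.cast_pow, map_mul, map_pow, Int.cast_ofNat] at hval
  have hΔ0 : v.valuation ℚ (M.Δ : ℚ) ≠ 0 :=
    (Valuation.ne_zero_iff _).mpr (by exact_mod_cast hΔ)
  have h2 : v.valuation ℚ (6 : ℚ) ^ 12 * v.valuation ℚ (M.Δ : ℚ) ≤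
      v.valuation ℚ (e : ℚ) ^ 12 * v.valuation ℚ (M.Δ : ℚ) := by
    rw [← hval]
    exact mul_le_mul_right hle _
  have h3 := mul_le_mul_left h2 (v.valuation ℚ (M.Δ : ℚ))⁻¹
  rwa [mul_assoc, mul_inv_cancel₀ hΔ0, mul_one, mul_assoc, mul_inv_cancel₀ hΔ0, mul_one] at h3

variable (V : WeierstrassCurve ℚ) [V.IsElliptic] [V.IsGloballyMinimal]

/-- **Minimality constraint at `ℓ ≥ 5`** (Silverman *AEC* Ex. 8.21 / VII.1 Remark 1.1): a globally
minimal `V/ℚ` cannot have both `ord_v c₄ ≥ 4` and `ord_v c₆ ≥ 6` at a place `v` over `ℓ ≥ 5`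
(take `e = ℓ` in `valuation_six_pow_le_of_isMinimalAt`: `|6|_v = 1`, `|ℓ|_v = exp(−1)`).
[cite: SilvermanAEC2009, Ex. 8.21 and VII.1 Remark 1.1] -/
theorem not_valuation_c₄_le_and_c₆_le_of_five_le (h5 : 5 ≤ (primesEquiv v : ℕ)) :
    ¬ (v.valuation ℚ V.c₄ ≤ exp (-(4 : ℤ)) ∧ v.valuation ℚ V.c₆ ≤ exp (-(6 : ℤ))) := by
  set ℓ : ℕ := (primesEquiv v : ℕ) with hℓdef
  have hℓ : ℓ.Prime := (primesEquiv v).2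
  set M : WeierstrassCurve ℤ := integralModelInt V with hM
  have hVM : M.baseChange ℚ = V := by
    rw [baseChange, algebraMap_int_eq, hM, map_integralModelInt]
  have hc₄ : V.c₄ = (M.c₄ : ℚ) := by rw [← hVM, baseChange, map_c₄, algebraMap_int_eq, eq_intCast]
  have hc₆ : V.c₆ = (M.c₆ : ℚ) := by rw [← hVM, baseChange, map_c₆, algebraMap_int_eq, eq_intCast]
  have hΔM : M.Δ ≠ 0 := by
    intro h0
    apply V.isUnit_Δ.ne_zero
    rw [← hVM, baseChange, map_Δ, h0, map_zero]
  have hminM : (M.baseChange ℚ).IsMinimalAt v := by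
    rw [hVM]; exact IsGloballyMinimal.isMinimal (W := V) v
  rintro ⟨h4, h6⟩
  rw [hc₄] at h4
  rw [hc₆] at h6
  obtain ⟨c', hc'⟩ := pow_dvd_of_valuation_intCast_le v (k := 4) (by exact_mod_cast h4)
  obtain ⟨c'', hc''⟩ := pow_dvd_of_valuation_intCast_le v (k := 6) (by exact_mod_cast h6)
  have hℓ0 : ((ℓ : ℕ) : ℤ) ≠ 0 := by exact_mod_cast hℓ.ne_zero
  have key := valuation_six_pow_le_of_isMinimalAt v M hΔM hminM (e := ℓ) (a4 := -27 * c')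
    (a6 := -54 * c'') hℓ0 (by rw [hc']; ring) (by rw [hc'']; ring)
  have h6u : v.valuation ℚ (6 : ℚ) = 1 := by
    have hnd : ¬ ((primesEquiv v : ℕ) : ℤ) ∣ 6 := by
      intro h
      have h' : ℓ ∣ 2 * 3 := by exact_mod_cast h
      rcases (Nat.Prime.dvd_mul hℓ).mp h' with h2 | h3
      · have := Nat.le_of_dvd (by norm_num) h2; omega
      · have := Nat.le_of_dvd (by norm_num) h3; omega
    have h := valuation_ringOfIntegers_intCast_eq_one v hnd
    exact_mod_cast h
  have hvℓ : v.valuation ℚ ((ℓ : ℕ) : ℤ) = exp (-1 : ℤ) := by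
    have h := valuation_ringOfIntegers_natCast_primesEquiv v
    exact_mod_cast h
  rw [h6u, one_pow, hvℓ, ← exp_nsmul, ← exp_zero, exp_le_exp] at key
  norm_num at key

/-- **`ord_v c₄ < 4` or `ord_v Δ < 12` at `ℓ ≥ 5`** for a globally minimal `V/ℚ` (from the previous
constraint and `c₆² = c₄³ − 1728 Δ`: `ord c₄ ≥ 4 ∧ ord Δ ≥ 12 ⇒ ord c₆ ≥ 6`). Silverman *AEC* VII.1
Remark 1.1 ("the converse holds for `char k ≠ 2, 3`"), Exercise 7.1.
[cite: SilvermanAEC2009, VII.1 Remark 1.1 and Exercise 7.1] -/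
theorem lt_valuation_c₄_or_lt_valuation_Δ_of_five_le (h5 : 5 ≤ (primesEquiv v : ℕ)) :
    exp (-(4 : ℤ)) < v.valuation ℚ V.c₄ ∨ exp (-(12 : ℤ)) < v.valuation ℚ V.Δ := by
  by_contra h
  push Not at h
  obtain ⟨h4, h12⟩ := h
  apply not_valuation_c₄_le_and_c₆_le_of_five_le v V h5
  refine ⟨h4, ?_⟩
  -- `c₆² = c₄³ − 1728 Δ`
  have hrel : V.c₆ ^ 2 = V.c₄ ^ 3 - 1728 * V.Δ := by
    rw [V.c_relation]; ring
  have h1728 : v.valuation ℚ (1728 : ℚ) ≤ 1 := by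
    have h := valuation_ringOfIntegers_intCast_le_one v 1728
    exact_mod_cast h
  have hsq : v.valuation ℚ V.c₆ ^ 2 ≤ exp (-(12 : ℤ)) := by
    rw [← map_pow, hrel]
    refine le_trans (Valuation.map_sub _ _ _) (max_le ?_ ?_)
    · rw [map_pow]
      calc v.valuation ℚ V.c₄ ^ 3 ≤ exp (-(4 : ℤ)) ^ 3 := pow_le_pow_left' h4 3
        _ = exp (-(12 : ℤ)) := by rw [← exp_nsmul]; norm_num
    · rw [map_mul]
      calc v.valuation ℚ 1728 * v.valuation ℚ V.Δ ≤ 1 * exp (-(12 : ℤ)) :=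
            mul_le_mul' h1728 h12
        _ = exp (-(12 : ℤ)) := one_mul _
  by_contra hlt
  push Not at hlt
  have : exp (-(12 : ℤ)) < v.valuation ℚ V.c₆ ^ 2 := by
    calc exp (-(12 : ℤ)) = exp (-(6 : ℤ)) ^ 2 := by rw [← exp_nsmul]; norm_num
      _ < v.valuation ℚ V.c₆ ^ 2 := pow_lt_pow_left₀ hlt zero_le two_ne_zero
  exact absurd hsq (not_le.mpr this)

end Kraus

/-! ## §2 Minimality, additive reduction and `ord Δ_min` above an unramified place, `ℓ ≥ 5` -/

section Unramified

variable (V : WeierstrassCurve ℚ) [V.IsElliptic] [V.IsGloballyMinimal] {v : HeightOneSpectrum (𝓞 ℚ)}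
  {K : Type} [Field K] [NumberField K] (w : HeightOneSpectrum (𝓞 K))

omit [V.IsElliptic] in
/-- `|x|_w = |x|_v` on `ℚ` above an UNRAMIFIED place (`e(w|v) = 1`; Mathlib `valuation_liesOver`).
[folklore] -/
theorem valuation_baseChange_eq_of_ramificationIdx_eq_one (hw : w.under (𝓞 ℚ) = v)
    (he : w.asIdeal.ramificationIdx (𝓞 ℚ) = 1) (x : ℚ) :
    w.valuation K (algebraMap ℚ K x) = v.valuation ℚ x := by
  haveI : w.asIdeal.LiesOver v.asIdeal := ⟨by rw [← hw]; rfl⟩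
  have h := IsDedekindDomain.HeightOneSpectrum.valuation_liesOver K v w x
  rw [ramificationIdx'_eq_of_under_eq hw, he, pow_one] at h
  exact h.symm

/-- **A `ℤ`-minimal equation stays minimal above an unramified place of residue characteristic
`≥ 5`**: for `V/ℚ` globally minimal, `K` any number field and `w ∣ v` with `e(w|v) = 1`, `ℓ_v ≥ 5`,
`V_K` is minimal at `w` — `ord_w c₄ = ord_v c₄ < 4` or `ord_w Δ = ord_v Δ < 12`
(`lt_valuation_c₄_or_lt_valuation_Δ_of_five_le`) and Silverman's criterion (tree
`isMinimalAt_of_lt_valuation_c₄`, `isMinimalAt_of_lt_valuation_Δ_holds`). Silverman *AEC* VII.5.4(a)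
proof / Ex. 7.1. [cite: SilvermanAEC2009, VII.1 Remark 1.1 and VII.5 Prop. 5.4(a)] -/
theorem isMinimalAt_baseChange_of_five_le_of_ramificationIdx_eq_one (h5 : 5 ≤ (primesEquiv v : ℕ))
    (hw : w.under (𝓞 ℚ) = v) (he : w.asIdeal.ramificationIdx (𝓞 ℚ) = 1) :
    (V.baseChange K).IsMinimalAt w := by
  have hint : (V.baseChange K).IsIntegralAt w := by
    rw [← baseChange_integralModelInt_eq]
    exact isIntegralAt_baseChange_intModel (integralModelInt V) w
  rcases lt_valuation_c₄_or_lt_valuation_Δ_of_five_le v V h5 with h | h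
  · refine isMinimalAt_of_lt_valuation_c₄ hint ?_
    rw [baseChange, map_c₄, valuation_baseChange_eq_of_ramificationIdx_eq_one w hw he]
    exact h
  · refine isMinimalAt_of_lt_valuation_Δ_holds hint ?_
    rw [baseChange, map_Δ, valuation_baseChange_eq_of_ramificationIdx_eq_one w hw he]
    exact h

/-- **`ord_w Δ_min(V_K) = e(w|v) · ord_v Δ_min(V)`** (`e = 1`) above an unramified place of residue
characteristic `≥ 5`: both minimal discriminants are read on the `ℤ`-minimal equation (tree
`valuation_Δ_eq_of_isMinimalAt_holds`). Stated with the factor `e` for the `δ`-lemma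
`valuation_u_eq_one_of_ordMinimalDiscriminant_eq` of FILE C-3c. [cite: SilvermanAEC2009, VII.1 Prop. 1.3(b)] -/
theorem ordMinimalDiscriminant_baseChange_eq_of_five_le_of_ramificationIdx_eq_one
    (h5 : 5 ≤ (primesEquiv v : ℕ)) (hw : w.under (𝓞 ℚ) = v)
    (he : w.asIdeal.ramificationIdx (𝓞 ℚ) = 1) :
    (V.baseChange K).ordMinimalDiscriminant w =
      w.asIdeal.ramificationIdx (𝓞 ℚ) * V.ordMinimalDiscriminant v := by
  haveI : (V.baseChange K).IsElliptic := by rw [baseChange]; infer_instance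
  have hK := valuation_Δ_eq_of_isMinimalAt_holds w (V.baseChange K)
    (isMinimalAt_baseChange_of_five_le_of_ramificationIdx_eq_one V w h5 hw he)
  have hQ := valuation_Δ_eq_of_isMinimalAt_holds v V (IsGloballyMinimal.isMinimal (W := V) v)
  rw [baseChange, map_Δ, valuation_baseChange_eq_of_ramificationIdx_eq_one w hw he, hQ, exp_inj,
    neg_inj] at hK
  rw [he, one_mul]
  exact_mod_cast hK.symm

/-- **Additive reduction persists above an unramified place of residue characteristic `≥ 5`**
(`V/ℚ` globally minimal additive at `v`, `e(w|v) = 1`): on the common minimal equation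
`ord Δ > 0` and `ord c₄ > 0` at `v`, hence at `w` (Silverman VII.5.1(c); tree
`hasAdditiveReductionAt_iff_of_isMinimalAt`). The fact-free `ℓ ≥ 5` case of the named fact A233
(`kodairaSymbolAt_baseChange_of_ramificationIdx_eq_one`) as far as the reduction TYPE (not the
Kodaira symbol) is concerned. [cite: SilvermanAEC2009, VII.5 Prop. 5.1(c) and Prop. 5.4(a)] -/
theorem hasAdditiveReductionAt_baseChange_of_five_le_of_ramificationIdx_eq_one
    (h5 : 5 ≤ (primesEquiv v : ℕ)) (hw : w.under (𝓞 ℚ) = v)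
    (he : w.asIdeal.ramificationIdx (𝓞 ℚ) = 1) (hadd : V.HasAdditiveReductionAt v) :
    (V.baseChange K).HasAdditiveReductionAt w := by
  haveI : (V.baseChange K).IsElliptic := by rw [baseChange]; infer_instance
  have hQ := (hasAdditiveReductionAt_iff_of_isMinimalAt (IsGloballyMinimal.isMinimal (W := V) v)).mp hadd
  refine (hasAdditiveReductionAt_iff_of_isMinimalAt
    (isMinimalAt_baseChange_of_five_le_of_ramificationIdx_eq_one V w h5 hw he)).mpr ?_
  rw [baseChange, map_Δ, map_c₄, valuation_baseChange_eq_of_ramificationIdx_eq_one w hw he,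
    valuation_baseChange_eq_of_ramificationIdx_eq_one w hw he]
  exact hQ

/-- **`v_p(c_w(V_K)) = 0` for `p ≥ 5` above an unramified additive place of residue characteristic
`≥ 5`**: `V_K` is additive at `w`, so `c_w ≤ 4 < p` (Kodaira–Néron; x11b
`kodairaNeron_localTamagawaNumber`). The `K`-side of (L_ℓ)@p at such a place.
[cite: SilvermanAEC2009, Thm. VII.6.1 and Cor. C.15.2.1] -/
theorem padicValNat_localTamagawaNumber_baseChange_eq_zero_of_addv_of_five_le
    (h5 : 5 ≤ (primesEquiv v : ℕ)) (hw : w.under (𝓞 ℚ) = v)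
    (he : w.asIdeal.ramificationIdx (𝓞 ℚ) = 1) (hadd : V.HasAdditiveReductionAt v)
    (p : ℕ) [Fact p.Prime] (hp5 : 5 ≤ p) :
    padicValNat p (((V.baseChange K).baseChange (w.adicCompletion K)).localTamagawaNumber
        (w.adicCompletionIntegers K)) = 0 := by
  haveI : (V.baseChange K).IsElliptic := by rw [baseChange]; infer_instance
  have haddK := hasAdditiveReductionAt_baseChange_of_five_le_of_ramificationIdx_eq_one V w h5 hw he hadd
  obtain ⟨h1, -, hle⟩ := X11b.kodairaNeron_localTamagawaNumber (V.baseChange K) w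
  have hns : ¬ (V.baseChange K).HasSplitMultiplicativeReductionAt w := fun hs =>
    haddK.not_hasMultiplicativeReductionAt hs.hasMultiplicativeReductionAt
  have h4 := hle hns
  refine padicValNat.eq_zero_of_not_dvd fun hdvd => ?_
  have := Nat.le_of_dvd (by omega) hdvd
  omega

end Unramified

end Summit.BirchSwinnertonDyer.Rank1Residual.AdditivePotMult

end
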